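import Mathlib.LinearAlgebra.Matrix.Determinant.Basic
import Mathlib.LinearAlgebra.Span.Defs
import Mathlib.RingTheory.Ideal.Span
import Mathlib.RingTheory.Ideal.Quotient.Defs
import Mathlib.LinearAlgebra.Matrix.Notation
import HarnessLib

/-!
# Fitting ideals of a module (Eisenbud, *Commutative Algebra*, §20.2; Stacks, Tag 07Z6)

Topic: `Literature/RingTheory/FittingIdeal`. The `k`-th **Fitting ideal** `Fitt_k(M) ⊆ R` of a
finitely generated module `M` over a commutative ring `R` (H. Fitting 1936; Eisenbud,
*Commutative Algebra with a View Toward Algebraic Geometry*, §20.2; The Stacks Project,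
Tag 07Z6): choose generators `x₁, …, xₙ` of `M`; `Fitt_k(M)` is the ideal generated by the
`(n - k) × (n - k)` minors of the matrix of all relations `∑ⱼ aⱼ xⱼ = 0` among them (the unit
ideal if `k ≥ n`); by Fitting's lemma (Stacks, Tag 07Z8) this does not depend on the choice of
generators. Mathlib has Kähler differentials, lengths and determinants but no Fitting ideals
(only the Fitting decomposition of Lie modules); the tree has the order ideal `Fitt₀` in the
intrinsic form `Literature.Topology.FourManifolds.Module.fittingIdeal` (Alexander ideals).

This file gives the general `Fitt_k` in the same INTRINSIC, presentation-free form — the ideal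
generated by the determinants of the `j × j` matrices extracted (rows: `j` relations; columns:
`j` of the generators) from relations among generating families of size `j + k`, over all such
families — so that no choice of presentation enters the definition (for a finitely generated
`M` all families give the same ideal by Fitting's lemma, hence so does their union; for `M` not
finitely generated the ideal is `⊥`). It is the notion by which de Jong 1996, 2.21 puts a scheme
structure on the singular locus of a semi-stable curve ("Let `Sing(f) ⊂ X` be the closed
subscheme defined by the first Fitting ideal of the sheaf `Ω_{X/S}`"), used in
`Literature/AlgebraicGeometry/Resolution` for the invariants `n_T` of loc. cit. 3.4.

## Content (all proved)

* `Module.fittingIdeal R M k` — the `k`-th Fitting ideal.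
* `Module.fittingIdeal_eq_top_of_span_eq_top` — `Fitt_k(M) = R` if `M` is generated by `k`
  elements (Stacks 07Z6: "`Fitt_k(M) = R` if `M` can be generated by `k` elements"; the empty
  minor).
* `Module.mem_fittingIdeal_zero_quotient` — for an ideal `I`, `I ⊆ Fitt₀(R/I)` (the relations
  `i · 1 = 0`; in fact equality, Stacks 07ZA).
* `Module.det_mem_fittingIdeal` — the defining generators: the determinant of a square matrix of
  relations among `j + k` generators, restricted to `j` of them, lies in `Fitt_k(M)`.

## Sources

* D. Eisenbud, *Commutative Algebra with a View Toward Algebraic Geometry*, GTM 150 (1995),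
  §20.2 (Fitting ideals), Cor. 20.4, Prop. 20.7.
* The Stacks Project, Tags 07Z6 (definition), 07Z8 (Fitting's lemma), 07ZA (basic properties).
* A. J. de Jong, *Smoothness, semi-stability and alterations*, Publ. Math. IHÉS 83 (1996), 2.21
  (p. 61).
-/

namespace Literature.RingTheory.FittingIdeal

universe u v

variable (R : Type u) [CommRing R] (M : Type v) [AddCommGroup M] [Module R M]

/-- The `k`-th **Fitting ideal** `Fitt_k(M)` of the `R`-module `M` (Eisenbud §20.2; Stacks 07Z6),
in intrinsic form: the ideal generated by the determinants `det (ρᵢ(σ i'))_{i,i'}` of the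
`j × j` matrices obtained from `j` relations `ρ₁, …, ρⱼ` (`∑ₗ ρᵢₗ • xₗ = 0`) among a generating
family `x : Fin (j + k) → M` of size `j + k` by keeping the `j` columns `σ : Fin j ↪ Fin (j + k)`,
over all `j`, all such generating families, relations and column choices. For `M` generated by
`x₁, …, xₙ` this is the ideal of `(n - k)`-minors of the full relation matrix (all generating
families giving the same ideal by Fitting's lemma, Stacks 07Z8; families of size `< k` are
accounted for by padding with zeros); for `M` not finitely generated it is `⊥`.
[cite: Eisenbud1995, §20.2] -/
def Module.fittingIdeal (k : ℕ) : Ideal R :=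
  Ideal.span {d : R | ∃ (j : ℕ) (x : Fin (j + k) → M) (ρ : Fin j → Fin (j + k) → R)
    (σ : Fin j ↪ Fin (j + k)),
    Submodule.span R (Set.range x) = ⊤ ∧ (∀ i, ∑ l, ρ i l • x l = 0) ∧
      d = Matrix.det (Matrix.of fun i i' => ρ i (σ i'))}

variable {R M}

/-- The defining generators of `Fitt_k(M)`: the determinant of `j` relations among a generating
family of size `j + k`, restricted to `j` of the generators, lies in `Fitt_k(M)`.
[cite: Eisenbud1995, §20.2] -/
theorem Module.det_mem_fittingIdeal {k j : ℕ} (x : Fin (j + k) → M)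
    (hx : Submodule.span R (Set.range x) = ⊤) (ρ : Fin j → Fin (j + k) → R)
    (hρ : ∀ i, ∑ l, ρ i l • x l = 0) (σ : Fin j ↪ Fin (j + k)) :
    Matrix.det (Matrix.of fun i i' => ρ i (σ i')) ∈ Module.fittingIdeal R M k :=
  Ideal.subset_span ⟨j, x, ρ, σ, hx, hρ, rfl⟩

/-- **`Fitt_k(M) = R` if `M` is generated by `k` elements** (Stacks 07Z6; Eisenbud §20.2): take
no relation and the empty minor, whose determinant is `1`. [cite: Eisenbud1995, §20.2] -/
theorem Module.fittingIdeal_eq_top_of_span_eq_top {k : ℕ} (x : Fin k → M)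
    (hx : Submodule.span R (Set.range x) = ⊤) : Module.fittingIdeal R M k = ⊤ := by
  rw [Ideal.eq_top_iff_one]
  -- the generating family of size `0 + k`
  let x' : Fin (0 + k) → M := fun i => x (i.cast (Nat.zero_add k))
  have hx' : Submodule.span R (Set.range x') = ⊤ := by
    have hr : Set.range x' = Set.range x := by
      ext m
      constructor
      · rintro ⟨i, rfl⟩
        exact ⟨i.cast (Nat.zero_add k), rfl⟩
      · rintro ⟨i, rfl⟩
        exact ⟨i.cast (Nat.zero_add k).symm, by simp [x']⟩
    rw [hr, hx]
  have h := Module.det_mem_fittingIdeal (R := R) (M := M) x' hx' (Fin.elim0 ·)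
    (fun i => Fin.elim0 i) ⟨Fin.elim0, fun i => Fin.elim0 i⟩
  rwa [Matrix.det_isEmpty] at h

/-- **`I ⊆ Fitt₀(R/I)`** (Stacks 07ZA (1): in fact `Fitt₀(R/I) = I`): the generator `1̄` of
`R/I` satisfies the relation `i • 1̄ = 0` for every `i ∈ I`, a `1 × 1` relation matrix with
determinant `i`. [cite: Eisenbud1995, §20.2] -/
theorem Module.mem_fittingIdeal_zero_quotient (I : Ideal R) {i : R} (hi : i ∈ I) :
    i ∈ Module.fittingIdeal R (R ⧸ I) 0 := by
  have h := Module.det_mem_fittingIdeal (R := R) (M := R ⧸ I) (k := 0) (j := 1)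
    (fun _ => (1 : R ⧸ I)) ?_ (fun _ _ => i) ?_ (Function.Embedding.refl _)
  · simpa using h
  · rw [Submodule.eq_top_iff']
    intro m
    obtain ⟨r, rfl⟩ := Ideal.Quotient.mk_surjective m
    have : Ideal.Quotient.mk I r = r • (1 : R ⧸ I) := by
      show Submodule.Quotient.mk r = r • (Submodule.Quotient.mk 1 : R ⧸ I)
      rw [← Submodule.Quotient.mk_smul, smul_eq_mul, mul_one]
    rw [this]
    exact Submodule.smul_mem _ _ (Submodule.subset_span ⟨0, rfl⟩)
  · intro l
    rw [Fin.sum_univ_one]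
    show i • (Submodule.Quotient.mk 1 : R ⧸ I) = 0
    rw [← Submodule.Quotient.mk_smul, smul_eq_mul, mul_one]
    exact (Submodule.Quotient.mk_eq_zero _).mpr hi

end Literature.RingTheory.FittingIdeal
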